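import Literature.AlgebraicGeometry.Resolution.AbhyankarEtaleAscent
import Mathlib.RingTheory.DedekindDomain.Different
import HarnessLib

/-!
# Knaf–Kuhlmann 2009, Lemma 3.7: a finite extension generated by a Hensel root is strongly smoothly `O_L`-uniformizable

Topic: `Literature/AlgebraicGeometry/Resolution`. A PROVED leaf under the named fact
`KnafKuhlmann2009_Thm38_Lemma37_sepClosed` (`KnafKuhlmann2009HenselianRationality.lean`;
Knaf–Kuhlmann 2009, Thm. 3.8 = F.-V. Kuhlmann's henselian rationality, combined with the
étale-local structure Lemma 3.7 (2), (3), as used in the printed proof of Prop. 3.10). The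
combination splits as

* Thm. 3.8 + Lemma 3.7 (3) ([Ray] X Thm. 1, V Thm. 1): `F = K(x)(η)` for a transcendental `x`
  and a HENSEL ROOT `η ∈ O_F` over `O_{K(x)}` — a root of a monic `f` over `O_{K(x)}` with
  `f'(η)` a unit — (the deep, purely valuation-theoretic kernel; it stays a named fact), and
* Lemma 3.7 (2) ⇐ together with the valuation-theoretic half of the proof of Lemma 3.7 (1):
  such an `F|L` is strongly smoothly `O_L`-uniformizable, on the standard-étale model
  `O_L[η][1/μ'(η)]` — THIS FILE, proved in full.

Lemma 3.7 (p. 13 of arXiv:math/0702856): "Let `(F|L,P)` be a finite valued field extension and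
let `R ⊆ O_L` be a subring of `L` with `Frac R = L = Frac O_L`. Then the following statements
hold: 1. If `P` is smoothly `R`-uniformizable, then `O_P|O_L` is local-étale. 2. `P` is strongly
smoothly `O_L`-uniformizable if and only if `O_P|O_L` is local-étale. 3. `O_P|O_L` is
local-étale if and only if `(F,P)` lies in the absolute inertia field of `(L,P)`." Its proof
of 1.: "as an étale extension of the normal domain `O_L` the domain `B` is normal too […].
Hence `B_{q_B}` is a normal local extension of `O_L` in the finite extension `F|L` and thus a
valuation domain contained in `O_P`. Since the valuation rings of `F` that are local
extensions of `O_L` are pairwise incomparable with respect to inclusion we get `B_{q_B} = O_P`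
as desired. 2.: The remaining implication ⇐ is obvious."

## Content

* `isIntegral_aeval_divX_iterate` — PROVED [folklore]: if `p(z) = 0` over `R` then the Horner
  partial sums `(divX^[k] p)(z) = ∑_{j ≥ k} pⱼ z^{j-k}` are integral over `R` (faithful
  finitely generated module `R + Rz + ⋯ + Rz^{n-1}`); with `coeff_divX_iterate`,
  `X_pow_mul_divX_iterate_add`, `natDegree_divX_iterate`, `divX_iterate_C` (cf. the twins in
  `Literature.NumberTheory.LFunctions.DegreeOnePrimes`, another namespace).
* `derivative_mul_mem_adjoin_of_isIntegral` — PROVED [folklore], Euler's lemma: for `A`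
  integrally closed with fraction field `K`, `L = K(x)` finite separable, `x` integral over `A`
  with minimal polynomial `f`, and `y ∈ L` integral over `A`: `f'(x) y ∈ A[x]` (Mathlib's
  `traceForm_dualSubmodule_adjoin` + `Algebra.isIntegral_trace`).
* `isFractionRing_inf` — `L = Frac (V ∩ L)`.
* `exists_standardEtale_model_inf` — PROVED: for `η ∈ O_V ∩ F` integral over `O_L = V ∩ L`
  whose minimal polynomial `μ` has `μ'(η) ∈ O_V^×`, the subalgebra `O_L[η][1/μ'(η)] ⊆ O_V ∩ F`
  is standard étale over `O_L` (Mathlib's `StandardEtalePair` with `f = μ`, `g = μ'`), hence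
  finitely presented and formally smooth.
* `exists_isIntegral_mul_eq` — PROVED: every `z ∈ O_V ∩ L(η)` is `r/s` with `r, s ∈ L(η)`
  integral over `O_L` and `v(s) = 0` (normalise the minimal polynomial of `z` over `L` by a
  coefficient of largest value; take the Horner sum from the last unit coefficient on).
* `isSmoothlyUniformizableIn_of_henselRoot` — PROVED, **Lemma 3.7 (2) ⇐ in Hensel-root
  form**: if `F = L(η)` with `η ∈ O_V` a root of a monic `f` over `O_L` with `v(f'(η)) = 0`,
  then every `Z ⊆ O_V ∩ F` is smoothly `O_L`-uniformizable (`IsSmoothlyUniformizableIn`), on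
  the single model `A = O_L[η][1/μ'(η)]`: `Frac A = F` and `O_F ⊆ A_q` since
  `z = (μ'(η) r)/(μ'(η) s)` with numerator and denominator in `O_L[η]` by Euler's lemma.

## Sources

* [KK09] H. Knaf, F.-V. Kuhlmann, *Every place admits local uniformization in a finite
  extension of the function field*, Adv. Math. 221 (2009) 428–453 = arXiv:math/0702856:
  §3.1 p. 11 (standard-étale algebras, "`φ(f') ∈ A^×`"), Lemma 3.7 and its proof (p. 13),
  proof of Prop. 3.10 (p. 14: "Lemma 3.7, (2) and (3) yield that `P` is strongly smoothly
  `O_{K(x)}`-uniformizable"). Pages of the arXiv PDF.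
* [Ray] M. Raynaud, *Anneaux locaux henséliens*, LNM 169 (1970), Ch. V Thm. 1, Ch. X Thm. 1
  (as cited in [KK09] and in Knaf–Kuhlmann 2005, §5 p. 12: "`O_F = A_q` for an étale
  `O_E`-algebra `A` […] we can assume that `A` is standard-étale, i.e. `A = O_E[x]_{g(x)}`").

## Rendering notes

Ambient form of `ValuedFunctionFields.lean`: `(Ω, V)` a valued field, `L ≤ F` subfields,
`O_L = V.toSubring ⊓ L.toSubring` (the base ring of `IsSmoothlyUniformizableIn`, as in
`KnafKuhlmann2009_Prop310_sepClosed`), `F = L(η)` as `Subfield.closure (L ∪ {η}) = F`;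
"`η` is a Hensel root over `O_L`" = `f` a monic polynomial over `Ω` with coefficients in
`V ∩ L`, `f(η) = 0`, `V.valuation (f'(η)) = 1` (values written multiplicatively). Inside the
proofs `F` is Mathlib's intermediate field `L⟮η⟯` over `↥L`, and `O_L → L → L⟮η⟯ → Ω` is a
scalar tower with `L = Frac O_L`; valuations of elements of `L`, `L⟮η⟯` are taken in `Ω`.
-/

noncomputable section

namespace Literature.AlgebraicGeometry.Resolution

universe u

open IsLocalRing Polynomial Pointwise

/-! ## Horner partial sums of an algebraic relation are integral -/

section Horner

variable {R : Type*} [CommRing R]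

/-- Coefficients of the iterated `divX`: `(divX^[k] p)_i = p_{i+k}`. [folklore] -/
theorem coeff_divX_iterate (p : R[X]) (k i : ℕ) : (divX^[k] p).coeff i = p.coeff (i + k) := by
  induction k generalizing i with
  | zero => simp
  | succ k ih =>
    rw [Function.iterate_succ_apply', coeff_divX, ih, Nat.add_right_comm, Nat.add_assoc]

/-- `X ^ k · divX^[k] p` is `p` minus its terms of degree `< k`. [folklore] -/
theorem X_pow_mul_divX_iterate_add (p : R[X]) (k : ℕ) :
    X ^ k * (divX^[k] p) + ∑ j ∈ Finset.range k, C (p.coeff j) * X ^ j = p := by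
  induction k with
  | zero => simp
  | succ k ih =>
    rw [Finset.sum_range_succ, Function.iterate_succ_apply',
      show p.coeff k = (divX^[k] p).coeff 0 by rw [coeff_divX_iterate, Nat.zero_add]]
    set q := divX^[k] p with hq
    have h1 : X ^ (k + 1) * divX q = X ^ k * (q - C (q.coeff 0)) := by
      have := divX_mul_X_add q
      rw [pow_succ, mul_assoc, X_mul, eq_sub_of_add_eq this]
    rw [h1]
    linear_combination ih

/-- The degree of the iterated `divX`. [folklore] -/
theorem natDegree_divX_iterate (p : R[X]) (k : ℕ) :
    (divX^[k] p).natDegree = p.natDegree - k := by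
  induction k with
  | zero => simp
  | succ k ih =>
    rw [Function.iterate_succ_apply', natDegree_divX_eq_natDegree_tsub_one, ih, Nat.sub_sub]

/-- Iterated `divX` kills constants. [folklore] -/
theorem divX_iterate_C (a : R) {k : ℕ} (hk : 0 < k) : divX^[k] (C a) = 0 := by
  obtain ⟨k, rfl⟩ := Nat.exists_eq_add_of_lt hk
  rw [Nat.zero_add, Function.iterate_succ_apply, divX_C]
  exact Function.iterate_fixed divX_zero k

/-- **The Horner partial sums of an algebraic relation are integral.** If `p(z) = 0` for a
polynomial `p = ∑ⱼ cⱼ Xʲ` over `R` (not necessarily monic) and `z` in a domain `S ⊇ R`, then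
every `∑_{j ≥ k} cⱼ z^{j-k} = (divX^[k] p)(z)` is integral over `R`: the `R`-module spanned by
`1, z, …, z^{n-1}`, `n = deg p`, is finitely generated, faithful and stable under multiplication
by these elements. (The classical lemma behind "`O_F` is the localisation of the integral
closure of `O_L`"; cf. the proof of Lemma 3.7 (1) in Knaf–Kuhlmann 2009.) [folklore] -/
theorem isIntegral_aeval_divX_iterate {S : Type*} [CommRing S] [IsDomain S] [Algebra R S]
    {p : R[X]} {z : S} (hp : aeval z p = 0) (k : ℕ) : IsIntegral R (aeval z (divX^[k] p)) := by
  classical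
  rcases Nat.eq_zero_or_pos k with rfl | hk
  · rw [Function.iterate_zero_apply, hp]; exact isIntegral_zero
  haveI : Nontrivial R := nontrivial_of_ne 1 0 fun h =>
    one_ne_zero (by rw [← map_one (algebraMap R S), h, map_zero] : (1 : S) = 0)
  set n := p.natDegree with hn
  by_cases hn0 : n = 0
  · rw [eq_C_of_natDegree_eq_zero hn0.symm.symm, divX_iterate_C _ hk, map_zero]
    exact isIntegral_zero
  -- the module `N = {g(z) : deg g < n}`
  let N : Submodule R S := (degreeLT R n).map (aeval z).toLinearMap
  have hmemN : ∀ g : R[X], g.natDegree < n → aeval z g ∈ N := fun g hg =>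
    Submodule.mem_map.mpr ⟨g, mem_degreeLT.mpr
      (lt_of_le_of_lt degree_le_natDegree (WithBot.coe_lt_coe.mpr hg)), rfl⟩
  have hNfg : N.FG := by
    refine Submodule.FG.map _ ?_
    rw [degreeLT_eq_span_X_pow]
    exact Submodule.fg_span (Finset.finite_toSet _)
  have hN1 : (1 : S) ∈ N := by
    have := hmemN 1 (by rw [natDegree_one]; exact Nat.pos_of_ne_zero hn0)
    rwa [map_one] at this
  have hNbot : N ≠ ⊥ := fun h => one_ne_zero ((Submodule.mem_bot R).mp (h ▸ hN1))
  set q := divX^[k] p with hq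
  -- the key identity `z^k q(z) = -(terms of degree < k of p)(z)`
  set pLow : R[X] := ∑ j ∈ Finset.range k, C (p.coeff j) * X ^ j with hpLow
  have hpLowdeg : pLow = 0 ∨ pLow.natDegree < k := by
    by_cases h0 : pLow = 0
    · exact Or.inl h0
    refine Or.inr ((natDegree_lt_iff_degree_lt h0).mpr ?_)
    rw [hpLow]
    refine lt_of_le_of_lt (degree_sum_le _ _) ?_
    refine (Finset.sup_lt_iff (WithBot.bot_lt_coe k)).mpr fun j hj => ?_
    exact lt_of_le_of_lt (degree_C_mul_X_pow_le j _)
      (WithBot.coe_lt_coe.mpr (Finset.mem_range.mp hj))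
  have hkey : X ^ k * q = p - pLow := eq_sub_of_add_eq (X_pow_mul_divX_iterate_add p k)
  have hqdeg : q.natDegree = n - k := natDegree_divX_iterate p k
  -- `q(z) · g(z) ∈ N` whenever `deg g < n`
  have hstab : ∀ g ∈ degreeLT R n, aeval z (q * g) ∈ N := by
    intro g hg
    rw [degreeLT_eq_span_X_pow] at hg
    refine Submodule.span_induction ?_ ?_ ?_ ?_ hg
    · intro g hg
      obtain ⟨i, hi, rfl⟩ := Finset.mem_image.mp (Finset.mem_coe.mp hg)
      have hin : i < n := Finset.mem_range.mp hi
      by_cases hik : i < k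
      · apply hmemN
        calc (q * X ^ i).natDegree ≤ q.natDegree + (X ^ i : R[X]).natDegree := natDegree_mul_le
          _ ≤ (n - k) + i := by rw [hqdeg]; exact Nat.add_le_add_left (natDegree_X_pow_le i) _
          _ < n := by omega
      · replace hik : k ≤ i := not_lt.mp hik
        have heq : aeval z (q * X ^ i) = aeval z (-(X ^ (i - k) * pLow)) := by
          have : q * X ^ i = X ^ (i - k) * (X ^ k * q) := by
            rw [← mul_assoc, ← pow_add, Nat.sub_add_cancel hik, mul_comm]
          rw [this, hkey]
          simp [hp]
        rw [heq]
        apply hmemN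
        rcases hpLowdeg with h0 | hlt
        · rw [h0, mul_zero, neg_zero, natDegree_zero]; exact Nat.pos_of_ne_zero hn0
        rw [natDegree_neg]
        calc (X ^ (i - k) * pLow).natDegree
            ≤ (X ^ (i - k) : R[X]).natDegree + pLow.natDegree := natDegree_mul_le
          _ ≤ (i - k) + pLow.natDegree := Nat.add_le_add_right (natDegree_X_pow_le _) _
          _ < n := by omega
    · rw [mul_zero, map_zero]; exact N.zero_mem
    · intro g₁ g₂ _ _ h₁ h₂
      rw [mul_add, map_add]; exact N.add_mem h₁ h₂
    · intro c g _ h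
      rw [mul_smul_comm, map_smul]; exact N.smul_mem c h
  refine isIntegral_of_smul_mem_submodule N hNbot hNfg _ fun m hm => ?_
  obtain ⟨g, hg, rfl⟩ := Submodule.mem_map.mp hm
  have := hstab g hg
  rw [map_mul] at this
  exact this

end Horner

/-! ## Euler's lemma: `f'(x)` lies in the conductor of `A[x]` -/

/-- **Euler's lemma** (the conductor of `A[x]` in the integral closure contains `f'(x)`): let
`A` be an integrally closed domain with fraction field `K`, `L = K(x)` a finite separable
extension generated by an element `x` integral over `A` with minimal polynomial `f`, and
`y ∈ L` integral over `A`; then `f'(x) · y ∈ A[x]`. (The trace dual of `A[x]` is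
`f'(x)⁻¹ A[x]` — Mathlib's `traceForm_dualSubmodule_adjoin` — and traces of integral elements
lie in `A`.) [folklore] -/
theorem derivative_mul_mem_adjoin_of_isIntegral (A K : Type*) {L : Type*} [CommRing A]
    [Field K] [Field L] [Algebra A K] [Algebra K L] [Algebra A L] [IsScalarTower A K L]
    [IsDomain A] [IsFractionRing A K] [FiniteDimensional K L] [Algebra.IsSeparable K L]
    [IsIntegrallyClosed A] {x : L} (hx : Algebra.adjoin K {x} = ⊤) (hAx : IsIntegral A x)
    {y : L} (hy : IsIntegral A y) :
    aeval x (derivative (minpoly K x)) * y ∈ Algebra.adjoin A {x} := by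
  have hδ0 : aeval x (derivative (minpoly K x)) ≠ 0 :=
    (Algebra.IsSeparable.isSeparable K x).aeval_derivative_ne_zero (minpoly.aeval K x)
  have hy' : y ∈ (Algebra.traceForm K L).dualSubmodule
      (Subalgebra.toSubmodule (Algebra.adjoin A {x})) := by
    rw [LinearMap.BilinForm.mem_dualSubmodule]
    intro a ha
    rw [Algebra.traceForm_apply]
    have haint : IsIntegral A a := by
      have hle : Algebra.adjoin A {x} ≤ integralClosure A L :=
        Algebra.adjoin_le (Set.singleton_subset_iff.mpr hAx)
      exact hle ha
    have htr : IsIntegral A (Algebra.trace K L (y * a)) :=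
      Algebra.isIntegral_trace (hy.mul haint)
    obtain ⟨c, hc⟩ := (IsIntegrallyClosed.isIntegral_iff (R := A) (K := K)).mp htr
    rw [Submodule.mem_one]
    exact ⟨c, hc⟩
  rw [traceForm_dualSubmodule_adjoin A K hx hAx, Submodule.mem_smul_pointwise_iff_exists] at hy'
  obtain ⟨b, hb, rfl⟩ := hy'
  rw [smul_eq_mul, ← mul_assoc, mul_inv_cancel₀ hδ0, one_mul]
  exact hb

variable {Ω : Type u} [Field Ω]

/-! ## The base ring `O_L = V ∩ L` -/

/-- `L` is the fraction field of `O_L = V ∩ L` (for any `O_L`-algebra structure on `L`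
compatible with the inclusions into `Ω`): `c ∈ L` is `c / 1` if `c ∈ V` and `1 / c⁻¹`
otherwise. [folklore] -/
theorem isFractionRing_inf (V : ValuationSubring Ω) (L : Subfield Ω)
    [Algebra ↥(V.toSubring ⊓ L.toSubring) L] [IsScalarTower ↥(V.toSubring ⊓ L.toSubring) L Ω] :
    IsFractionRing ↥(V.toSubring ⊓ L.toSubring) L := by
  have halg : ∀ c : ↥(V.toSubring ⊓ L.toSubring),
      ((algebraMap ↥(V.toSubring ⊓ L.toSubring) L c : L) : Ω) = c := fun c =>
    (IsScalarTower.algebraMap_apply ↥(V.toSubring ⊓ L.toSubring) L Ω c).symm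
  have hinj : Function.Injective (algebraMap ↥(V.toSubring ⊓ L.toSubring) L) := fun a b h =>
    Subtype.ext (by rw [← halg a, ← halg b, h])
  haveI : FaithfulSMul ↥(V.toSubring ⊓ L.toSubring) L :=
    (faithfulSMul_iff_algebraMap_injective _ _).mpr hinj
  refine IsFractionRing.of_field _ _ fun z => ?_
  rcases V.mem_or_inv_mem (z : Ω) with h | h
  · refine ⟨⟨z, h, z.2⟩, 1, ?_⟩
    rw [map_one, div_one]
    exact Subtype.ext (halg ⟨z, h, z.2⟩).symm
  · refine ⟨1, ⟨(z : Ω)⁻¹, h, L.inv_mem z.2⟩, ?_⟩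
    rw [map_one]
    apply Subtype.ext
    rw [Subfield.coe_div, halg, Subfield.coe_one, one_div, inv_inv]

/-! ## The standard-étale model `O_L[η][1/μ'(η)]` -/

/-- **The standard-étale model `O_L[η][1/μ'(η)]`.** Let `O_L = V ∩ L`, `η ∈ O_V ∩ F`, `L ≤ F`,
integral over `O_L` with minimal polynomial `μ` (over the normal domain `O_L`) such that
`μ'(η)` is a unit of `O_V`. Then `A := O_L[η][1/μ'(η)] ≅ (O_L[X]/(μ))_{μ'}` is a
standard-étale `O_L`-algebra (Mathlib's `StandardEtalePair`, with `f = μ`, `g = μ'`) inside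
`O_V ∩ F`: finitely presented and formally smooth over `O_L`, containing `O_L[η]` and
`μ'(η)⁻¹`. (Knaf–Kuhlmann 2009, §3.1: standard-étale algebras `R[X]_g/(f)`, `f` monic,
`φ(f')` a unit.) [cite: KnafKuhlmann2009, Section 3.1 (p. 11)] -/
theorem exists_standardEtale_model_inf (V : ValuationSubring Ω) (L : Subfield Ω)
    {F : Subfield Ω} (hLF : L ≤ F) {η : Ω} (hηV : η ∈ V) (hηF : η ∈ F)
    (hint : IsIntegral ↥(V.toSubring ⊓ L.toSubring) η)
    (hder : V.valuation (aeval η (derivative (minpoly ↥(V.toSubring ⊓ L.toSubring) η))) = 1) :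
    ∃ (A : Subalgebra ↥(V.toSubring ⊓ L.toSubring) Ω) (_ : A.toSubring ≤ V.toSubring),
      (A : Set Ω) ⊆ F ∧ Algebra.FinitePresentation ↥(V.toSubring ⊓ L.toSubring) A ∧
      Algebra.FormallySmooth ↥(V.toSubring ⊓ L.toSubring) A ∧
      (∀ q : Polynomial ↥(V.toSubring ⊓ L.toSubring), aeval η q ∈ A) ∧
      (aeval η (derivative (minpoly ↥(V.toSubring ⊓ L.toSubring) η)))⁻¹ ∈ A := by
  classical
  set O : Subring Ω := V.toSubring ⊓ L.toSubring with hO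
  haveI : IsIntegrallyClosed O := isIntegrallyClosed_inf V L
  set μ : Polynomial O := minpoly O η with hμ
  have hμmon : μ.Monic := minpoly.monic hint
  have hμη : aeval η μ = 0 := minpoly.aeval O η
  set δ : Ω := aeval η (derivative μ) with hδ
  have hδ0 : δ ≠ 0 := fun h0 => by
    rw [h0, map_zero] at hder
    exact zero_ne_one hder
  -- `φ₀ : O[X]/(μ) → Ω`, `X ↦ η`, is injective (`μ` is the minimal polynomial over the normal `O`)
  let φ₀ : AdjoinRoot μ →ₐ[O] Ω := AdjoinRoot.liftAlgHom μ (Algebra.ofId O Ω) η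
    (by rw [Algebra.toRingHom_ofId, ← Polynomial.aeval_def]; exact hμη)
  have hφ₀mk : ∀ q : Polynomial O, φ₀ (AdjoinRoot.mk μ q) = aeval η q := fun q => by
    simp only [φ₀, AdjoinRoot.liftAlgHom_mk, Polynomial.aeval_def, Algebra.toRingHom_ofId]
  have hφ₀ : Function.Injective φ₀ := by
    rw [injective_iff_map_eq_zero]
    intro p hp
    obtain ⟨q, rfl⟩ := AdjoinRoot.mk_surjective p
    rw [hφ₀mk] at hp
    rw [AdjoinRoot.mk_eq_zero, hμ]
    exact minpoly.isIntegrallyClosed_dvd hint hp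
  -- the standard-étale algebra `Lc = (O[X]/(μ))[1/μ']` and `ψ : Lc → Ω`
  set r : AdjoinRoot μ := AdjoinRoot.mk μ (derivative μ) with hr
  have hφ₀r : φ₀ r = δ := by rw [hr, hφ₀mk]
  have hrunit : IsUnit (φ₀ r) := by rw [hφ₀r]; exact isUnit_iff_ne_zero.mpr hδ0
  let Lc := Localization.Away r
  let ψ : Lc →ₐ[O] Ω := IsLocalization.Away.liftAlgHom r (f := φ₀) hrunit
  have hψalg : ∀ a : AdjoinRoot μ, ψ (algebraMap (AdjoinRoot μ) Lc a) = φ₀ a := fun a => by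
    simp only [ψ, IsLocalization.Away.coe_liftAlgHom, IsLocalization.Away.lift_eq]
    rfl
  have hnf : ∀ l : Lc, ∃ (q : Polynomial O) (n : ℕ), ψ l = aeval η q / δ ^ n := by
    intro l
    obtain ⟨⟨a, m⟩, hlm⟩ := IsLocalization.surj (Submonoid.powers r) l
    obtain ⟨n, hn⟩ := (Submonoid.mem_powers_iff _ _).mp m.2
    obtain ⟨q, rfl⟩ := AdjoinRoot.mk_surjective a
    refine ⟨q, n, ?_⟩
    have h1 : ψ l * δ ^ n = aeval η q := by
      have := congrArg ψ hlm
      rw [map_mul, hψalg, hψalg, hφ₀mk] at this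
      rw [← this, ← hn, map_pow, hφ₀r]
    rw [← h1, mul_div_assoc, div_self (pow_ne_zero n hδ0), mul_one]
  have hψ : Function.Injective ψ := by
    rw [injective_iff_map_eq_zero]
    intro l hl
    obtain ⟨⟨a, m⟩, hlm⟩ := IsLocalization.surj (Submonoid.powers r) l
    have h1 : φ₀ a = 0 := by
      have := congrArg ψ hlm
      rw [map_mul, hψalg, hψalg, hl, zero_mul] at this
      exact this.symm
    have ha : a = 0 := hφ₀ (by rw [h1, map_zero])
    rw [ha, map_zero] at hlm
    exact (IsLocalization.map_units Lc m).mul_left_eq_zero.mp hlm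
  -- `Lc` is standard étale over `O`; so is its image `A = ψ(Lc) ⊆ Ω`
  let SE : StandardEtalePair O :=
    { f := μ, monic_f := hμmon, g := derivative μ, cond := ⟨1, 0, 1, by ring⟩ }
  haveI : Algebra.IsStandardEtale O Lc := Algebra.IsStandardEtale.of_equiv SE.equivAwayAdjoinRoot
  haveI : Algebra.Etale O Lc := inferInstance
  haveI hfsL : Algebra.FormallySmooth O Lc := inferInstance
  haveI hfpL : Algebra.FinitePresentation O Lc := inferInstance
  set A : Subalgebra O Ω := ψ.range with hA
  let eA : Lc ≃ₐ[O] A := AlgEquiv.ofInjective ψ hψ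
  have hfpA : Algebra.FinitePresentation O A := Algebra.FinitePresentation.equiv eA
  have hfsA : Algebra.FormallySmooth O A := Algebra.FormallySmooth.of_equiv eA
  -- membership facts for `A`
  have hmemA : ∀ w : Ω, w ∈ A ↔ ∃ l, ψ l = w := fun w => AlgHom.mem_range ψ
  have hpolyA : ∀ q : Polynomial O, aeval η q ∈ A := fun q =>
    (hmemA _).mpr ⟨algebraMap _ Lc (AdjoinRoot.mk μ q), by rw [hψalg, hφ₀mk]⟩
  have hδinvA : δ⁻¹ ∈ A := by
    refine (hmemA _).mpr ⟨IsLocalization.Away.invSelf r, ?_⟩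
    have h1 : δ * ψ (IsLocalization.Away.invSelf r) = 1 := by
      rw [← hφ₀r, ← hψalg, ← map_mul, IsLocalization.Away.mul_invSelf, map_one]
    exact eq_inv_of_mul_eq_one_right h1
  have hOV : ∀ c : O, (c : Ω) ∈ V := fun c => c.2.1
  have hOL : ∀ c : O, (c : Ω) ∈ L := fun c => c.2.2
  have hnumV : ∀ q : Polynomial O, aeval η q ∈ V := fun q => by
    rw [aeval_eq_sum_range]
    exact sum_mem fun k _ => by
      rw [Algebra.smul_def]; exact mul_mem (hOV _) (pow_mem hηV k)
  have hnumF : ∀ q : Polynomial O, aeval η q ∈ F := fun q => by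
    rw [aeval_eq_sum_range]
    exact sum_mem fun k _ => by
      rw [Algebra.smul_def]; exact mul_mem (hLF (hOL _)) (pow_mem hηF k)
  have hδpowV : ∀ n : ℕ, (δ ^ n)⁻¹ ∈ V := fun n =>
    (V.valuation_le_one_iff _).mp (by rw [map_inv₀, map_pow, hder, one_pow, inv_one])
  have hAV : A.toSubring ≤ V.toSubring := by
    intro w hw
    obtain ⟨l, rfl⟩ := (hmemA w).mp hw
    obtain ⟨q, n, hq⟩ := hnf l
    rw [hq, div_eq_mul_inv]
    exact mul_mem (hnumV q) (hδpowV n)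
  have hAF : (A : Set Ω) ⊆ F := by
    intro w hw
    obtain ⟨l, rfl⟩ := (hmemA w).mp hw
    obtain ⟨q, n, hq⟩ := hnf l
    rw [hq]
    exact div_mem (hnumF q) (pow_mem (hnumF (derivative μ)) n)
  exact ⟨A, hAV, hAF, hfpA, hfsA, hpolyA, hδinvA⟩

/-! ## Elements of `O_F` as quotients of integral elements -/

/-- **`O_F` lies in the localisation of the integral closure of `O_L`.** For `F = L(η)` finite
over `L` (as the intermediate field `L⟮η⟯`) and `z ∈ O_V ∩ F`: there are `r, s ∈ F` integral
over `O_L = V ∩ L` with `v(s) = 0` and `z = r / s`. Proof: normalise the minimal polynomial of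
`z` over `L` by a coefficient of largest value to get `∑ dⱼ zʲ = 0` with `dⱼ ∈ O_L` and some
`d_k` a unit, `k` largest; then `s := ∑_{j ≥ k} dⱼ z^{j-k}` is a unit of `O_V` (`v(z) ≥ 0`) and
`s`, `z s = ∑_{j ≥ k-1} dⱼ z^{j-k+1} - d_{k-1}` are integral (`isIntegral_aeval_divX_iterate`).
(The valuation-theoretic step of the proof of Lemma 3.7 (1) in Knaf–Kuhlmann 2009: a local
extension of `O_L` inside the finite extension `F|L` that is a valuation ring is `O_P`.)
[folklore] -/
theorem exists_isIntegral_mul_eq (V : ValuationSubring Ω) (L : Subfield Ω) (η : Ω)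
    [Algebra ↥(V.toSubring ⊓ L.toSubring) L] [IsScalarTower ↥(V.toSubring ⊓ L.toSubring) L Ω]
    [FiniteDimensional L ↥(IntermediateField.adjoin L ({η} : Set Ω))]
    {z : Ω} (hzV : z ∈ V) (hzF : z ∈ IntermediateField.adjoin L ({η} : Set Ω)) :
    ∃ r s : ↥(IntermediateField.adjoin L ({η} : Set Ω)),
      IsIntegral ↥(V.toSubring ⊓ L.toSubring) r ∧ IsIntegral ↥(V.toSubring ⊓ L.toSubring) s ∧
      V.valuation (s : Ω) = 1 ∧ (r : Ω) = z * s := by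
  classical
  have hO : ∀ c : ↥(V.toSubring ⊓ L.toSubring),
      ((algebraMap ↥(V.toSubring ⊓ L.toSubring) L c : L) : Ω) = c := fun c =>
    (IsScalarTower.algebraMap_apply ↥(V.toSubring ⊓ L.toSubring) L Ω c).symm
  set Fη : IntermediateField L Ω := IntermediateField.adjoin L ({η} : Set Ω) with hFη
  haveI i2 : IsScalarTower ↥(V.toSubring ⊓ L.toSubring) L Fη :=
    IsScalarTower.of_algebraMap_eq fun c => Subtype.ext
      (show ((c : ↥(V.toSubring ⊓ L.toSubring)) : Ω) = ((algebraMap _ L c : L) : Ω) from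
        (hO c).symm)
  have coeAeval : ∀ (a : Fη) (q : Polynomial ↥(V.toSubring ⊓ L.toSubring)),
      ((aeval a q : Fη) : Ω) = aeval (a : Ω) q :=
    fun a q => (IntermediateField.aeval_coe Fη a q).symm
  have hinjOL : Function.Injective (algebraMap ↥(V.toSubring ⊓ L.toSubring) L) := fun a b h =>
    Subtype.ext (by rw [← hO a, ← hO b, h])
  set zF : Fη := ⟨z, hzF⟩ with hzFdef
  have hzint : IsIntegral L zF := IsIntegral.of_finite L zF
  set p : Polynomial L := minpoly L zF with hp
  set n := p.natDegree with hn
  have hpz : aeval zF p = 0 := minpoly.aeval L zF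
  have hpn : p.coeff n = 1 := (minpoly.monic hzint).coeff_natDegree
  -- a coefficient of maximal value
  obtain ⟨j₀, hj₀, hmax⟩ := Finset.exists_max_image (Finset.range (n + 1))
    (fun j => V.valuation ((p.coeff j : L) : Ω)) ⟨n, Finset.self_mem_range_succ n⟩
  set c : L := p.coeff j₀ with hc
  have hc1 : 1 ≤ V.valuation ((c : L) : Ω) := by
    have := hmax n (Finset.self_mem_range_succ n)
    rwa [hpn, Subfield.coe_one, map_one] at this
  have hvc0 : V.valuation ((c : L) : Ω) ≠ 0 := ne_of_gt (lt_of_lt_of_le zero_lt_one hc1)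
  have hc0 : c ≠ 0 := fun h => hvc0 (by rw [h, Subfield.coe_zero, map_zero])
  -- normalise: `p₁ := c⁻¹ p` has coefficients in `O_L`
  set p₁ : Polynomial L := C c⁻¹ * p with hp₁
  have hp₁coeff : ∀ j, ((p₁.coeff j : L) : Ω) ∈ V := by
    intro j
    rw [hp₁, coeff_C_mul, Subfield.coe_mul, ← V.valuation_le_one_iff, map_mul, Subfield.coe_inv,
      map_inv₀]
    by_cases hj : j ∈ Finset.range (n + 1)
    · rw [inv_mul_le_iff₀ (zero_lt_iff.mpr hvc0), mul_one]
      exact hmax j hj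
    · have : p.coeff j = 0 := by
        apply coeff_eq_zero_of_natDegree_lt
        simpa [Finset.mem_range, Nat.lt_succ_iff, not_le] using hj
      rw [this, Subfield.coe_zero, map_zero, mul_zero]
      exact zero_le_one
  obtain ⟨p₂, hp₂⟩ : ∃ p₂ : Polynomial ↥(V.toSubring ⊓ L.toSubring),
      p₂.map (algebraMap _ L) = p₁ := by
    refine (Polynomial.mem_lifts p₁).mp ((Polynomial.lifts_iff_coeff_lifts p₁).mpr fun j => ?_)
    exact ⟨⟨(p₁.coeff j : Ω), hp₁coeff j, (p₁.coeff j).2⟩, Subtype.ext (hO _)⟩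
  have hp₂coe : ∀ j, ((p₂.coeff j : ↥(V.toSubring ⊓ L.toSubring)) : Ω) =
      ((p₁.coeff j : L) : Ω) := by
    intro j
    rw [← hO, ← Polynomial.coeff_map, hp₂]
  have hp₂z : aeval zF p₂ = 0 := by
    rw [← aeval_map_algebraMap L, hp₂, hp₁, map_mul, hpz, mul_zero]
  have hp₂deg : p₂.natDegree = n := by
    rw [← natDegree_map_eq_of_injective hinjOL, hp₂, hp₁, natDegree_C_mul (inv_ne_zero hc0)]
  -- `k :=` the largest index of a coefficient of value `1`
  have hvj₀ : V.valuation ((p₂.coeff j₀ : ↥(V.toSubring ⊓ L.toSubring)) : Ω) = 1 := by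
    rw [hp₂coe, hp₁, coeff_C_mul, ← hc, inv_mul_cancel₀ hc0, Subfield.coe_one, map_one]
  obtain ⟨k, hk, hkmax⟩ := Finset.exists_max_image
    ((Finset.range (n + 1)).filter fun j =>
      V.valuation ((p₂.coeff j : ↥(V.toSubring ⊓ L.toSubring)) : Ω) = 1) id
    ⟨j₀, Finset.mem_filter.mpr ⟨hj₀, hvj₀⟩⟩
  have hvk : V.valuation ((p₂.coeff k : ↥(V.toSubring ⊓ L.toSubring)) : Ω) = 1 :=
    (Finset.mem_filter.mp hk).2
  have hlt : ∀ j, k < j →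
      V.valuation ((p₂.coeff j : ↥(V.toSubring ⊓ L.toSubring)) : Ω) < 1 := by
    intro j hj
    have hle : V.valuation ((p₂.coeff j : ↥(V.toSubring ⊓ L.toSubring)) : Ω) ≤ 1 :=
      (V.valuation_le_one_iff _).mpr (p₂.coeff j).2.1
    refine lt_of_le_of_ne hle fun h1 => ?_
    by_cases hjn : j ∈ Finset.range (n + 1)
    · exact absurd (hkmax j (Finset.mem_filter.mpr ⟨hjn, h1⟩)) (not_le.mpr hj)
    · have : p₂.coeff j = 0 := by
        apply coeff_eq_zero_of_natDegree_lt
        rw [hp₂deg]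
        simpa [Finset.mem_range, Nat.lt_succ_iff, not_le] using hjn
      rw [this, ZeroMemClass.coe_zero, map_zero] at h1
      exact zero_ne_one h1
  -- `s := ∑_{j ≥ k} dⱼ z^{j-k}` and `r := z s`
  set q := divX^[k] p₂ with hq
  set s : Fη := aeval zF q with hs
  refine ⟨zF * s, s, ?_, isIntegral_aeval_divX_iterate hp₂z k, ?_, ?_⟩
  · -- `z s = s_{k-1} - d_{k-1}` is integral
    rcases Nat.eq_zero_or_pos k with hk0 | hkpos
    · have : s = 0 := by rw [hs, hq, hk0, Function.iterate_zero_apply, hp₂z]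
      rw [this, mul_zero]
      exact isIntegral_zero
    · obtain ⟨k', hk'⟩ : ∃ k', k = k' + 1 := ⟨k - 1, by omega⟩
      have hs' : s = aeval zF (divX (divX^[k'] p₂)) := by
        rw [hs, hq, hk', show divX^[k' + 1] p₂ = divX (divX^[k'] p₂) from
          Function.iterate_succ_apply' divX k' p₂]
      have h := congrArg (aeval zF) (divX_mul_X_add (divX^[k'] p₂))
      rw [map_add, map_mul, aeval_X, aeval_C, ← hs'] at h
      have : zF * s = aeval zF (divX^[k'] p₂) -
          algebraMap ↥(V.toSubring ⊓ L.toSubring) Fη ((divX^[k'] p₂).coeff 0) := by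
        rw [mul_comm, eq_sub_iff_add_eq, h]
      rw [this]
      exact (isIntegral_aeval_divX_iterate hp₂z k').sub isIntegral_algebraMap
  · -- `v(s) = 1`: the term `d_k` dominates
    have hscoe : (s : Ω) = ∑ i ∈ Finset.range (q.natDegree + 1),
        ((q.coeff i : ↥(V.toSubring ⊓ L.toSubring)) : Ω) * z ^ i := by
      rw [hs, coeAeval, aeval_eq_sum_range]
      refine Finset.sum_congr rfl fun i _ => ?_
      rw [Algebra.smul_def]
      rfl
    rw [hscoe, Finset.sum_range_succ', pow_zero, mul_one, hq, coeff_divX_iterate, Nat.zero_add]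
    rw [Valuation.map_add_eq_of_lt_right]
    · exact hvk
    · rw [hvk]
      refine V.valuation.map_sum_lt one_ne_zero fun i _ => ?_
      rw [map_mul, map_pow, coeff_divX_iterate]
      have h1 := hlt (i + 1 + k) (by omega)
      have h2 : V.valuation z ^ (i + 1) ≤ 1 :=
        pow_le_one' ((V.valuation_le_one_iff z).mpr hzV) _
      exact lt_of_le_of_lt (mul_le_of_le_one_right' h2) h1
  · rfl

/-! ## Knaf–Kuhlmann 2009, Lemma 3.7 (2): the Hensel-root case -/

/-- **Knaf–Kuhlmann 2009, Lemma 3.7 (2) ⇐, with the valuation-theoretic part of (1)**, in the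
standard-étale (Hensel-root) form: let `L ≤ F` be subfields of the valued field `(Ω, V)` with
`F = L(η)` for an element `η ∈ O_V` which is a root of a monic polynomial `f` over
`O_L = V ∩ L` with `f'(η)` a unit of `O_V` (so that `O_F | O_L` is local-étale and `(F, P)` lies
in the henselization of `(L, P)`). Then `P = V ∩ F` is strongly smoothly `O_L`-uniformizable;
indeed the single standard-étale model `A = O_L[η][1/μ'(η)]` (`μ` the minimal polynomial of
`η`) serves every `Z ⊆ O_F`: `A` is finitely presented and smooth over `O_L`, `Frac A = F`, and
`O_F ⊆ A_q`, because every `z ∈ O_F` is `r/s` with `r, s` integral over `O_L`, `v(s) = 0`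
(`exists_isIntegral_mul_eq`) and `μ'(η) r, μ'(η) s ∈ O_L[η]` (Euler's lemma
`derivative_mul_mem_adjoin_of_isIntegral`). Lemma 3.7: "Let `(F|L,P)` be a finite valued field
extension […] 2. `P` is strongly smoothly `O_L`-uniformizable if and only if `O_P|O_L` is
local-étale."; proof of 1.: "`B_{q_B}` is a normal local extension of `O_L` in the finite
extension `F|L` and thus a valuation domain contained in `O_P` […] we get `B_{q_B} = O_P`".
[cite: KnafKuhlmann2009, Lemma 3.7] -/
theorem isSmoothlyUniformizableIn_of_henselRoot (V : ValuationSubring Ω) (L F : Subfield Ω)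
    {η : Ω} (hηV : η ∈ V) (hgen : Subfield.closure ((L : Set Ω) ∪ {η}) = F)
    (f : Polynomial Ω) (hfmon : f.Monic) (hfcoeff : ∀ k, f.coeff k ∈ V ∧ f.coeff k ∈ L)
    (hfη : f.eval η = 0) (hfder : V.valuation ((derivative f).eval η) = 1)
    (Z : Set Ω) (hZ : ∀ z ∈ Z, z ∈ V ∧ z ∈ F) :
    IsSmoothlyUniformizableIn ↥(V.toSubring ⊓ L.toSubring) V F Z := by
  classical
  haveI : IsIntegrallyClosed ↥(V.toSubring ⊓ L.toSubring) := isIntegrallyClosed_inf V L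
  have hLF : L ≤ F := fun c hc => hgen ▸ Subfield.subset_closure (Or.inl hc)
  have hηF : η ∈ F := hgen ▸ Subfield.subset_closure (Or.inr rfl)
  -- `f` over `O_L`; `η` is integral with minimal polynomial `μ`, `δ := μ'(η)` a unit of `O_V`
  obtain ⟨fO, hfO, hfOmon⟩ : ∃ fO : Polynomial ↥(V.toSubring ⊓ L.toSubring),
      fO.map (algebraMap _ Ω) = f ∧ fO.Monic := by
    have hl : f ∈ Polynomial.lifts (algebraMap ↥(V.toSubring ⊓ L.toSubring) Ω) :=
      (Polynomial.lifts_iff_coeff_lifts f).mpr fun k =>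
        ⟨⟨f.coeff k, (hfcoeff k).1, (hfcoeff k).2⟩, rfl⟩
    obtain ⟨fO, hfO, -, hmon⟩ := Polynomial.lifts_and_degree_eq_and_monic hl hfmon
    exact ⟨fO, hfO, hmon⟩
  have hfOη : aeval η fO = 0 := by rw [aeval_def, ← eval_map, hfO, hfη]
  have hint : IsIntegral ↥(V.toSubring ⊓ L.toSubring) η := ⟨fO, hfOmon, by rw [← aeval_def, hfOη]⟩
  set μ := minpoly ↥(V.toSubring ⊓ L.toSubring) η with hμ
  set δ : Ω := aeval η (derivative μ) with hδ
  have hOval : ∀ q : Polynomial ↥(V.toSubring ⊓ L.toSubring), V.valuation (aeval η q) ≤ 1 := by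
    intro q
    rw [V.valuation_le_one_iff, aeval_eq_sum_range]
    exact sum_mem fun k _ => by
      rw [Algebra.smul_def]; exact mul_mem (q.coeff k).2.1 (pow_mem hηV k)
  have hder : V.valuation δ = 1 := by
    obtain ⟨g, hg⟩ := minpoly.isIntegrallyClosed_dvd hint hfOη
    have h1 : (derivative f).eval η = δ * aeval η g := by
      rw [← hfO, derivative_map, eval_map, ← aeval_def, hg, derivative_mul, map_add, map_mul,
        map_mul, minpoly.aeval, zero_mul, add_zero]
    rw [h1, map_mul] at hfder
    refine le_antisymm (hOval _) ?_
    calc (1 : V.ValueGroup) = V.valuation δ * V.valuation (aeval η g) := hfder.symm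
      _ ≤ V.valuation δ := mul_le_of_le_one_right' (hOval g)
  have hδ0 : δ ≠ 0 := fun h0 => by rw [h0, map_zero] at hder; exact zero_ne_one hder
  obtain ⟨A, hAV, hAF, hfpA, hfsA, hpolyA, hδinvA⟩ :=
    exists_standardEtale_model_inf V L hLF hηV hηF hint hder
  haveI := hfsA
  -- the tower `O_L → L → L⟮η⟯ = F`
  let ι : ↥(V.toSubring ⊓ L.toSubring) →+* L :=
    Subring.inclusion (inf_le_right : V.toSubring ⊓ L.toSubring ≤ L.toSubring)
  letI : Algebra ↥(V.toSubring ⊓ L.toSubring) L := ι.toAlgebra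
  haveI : IsScalarTower ↥(V.toSubring ⊓ L.toSubring) L Ω :=
    IsScalarTower.of_algebraMap_eq fun _ => rfl
  haveI : IsFractionRing ↥(V.toSubring ⊓ L.toSubring) L := isFractionRing_inf V L
  set Fη : IntermediateField L Ω := IntermediateField.adjoin L ({η} : Set Ω) with hFη
  haveI : IsScalarTower ↥(V.toSubring ⊓ L.toSubring) L Fη :=
    IsScalarTower.of_algebraMap_eq fun _ => rfl
  haveI : IsScalarTower ↥(V.toSubring ⊓ L.toSubring) Fη Ω :=
    IsScalarTower.of_algebraMap_eq fun _ => rfl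
  have hηint : IsIntegral L η := hint.tower_top
  haveI : FiniteDimensional L Fη := IntermediateField.adjoin.finiteDimensional hηint
  have hmin : minpoly L η = μ.map (algebraMap _ L) :=
    minpoly.isIntegrallyClosed_eq_field_fractions' L hint
  have hsep : IsSeparable L η := by
    refine (separable_iff_derivative_ne_zero (minpoly.irreducible hηint)).mpr fun h0 => hδ0 ?_
    have : aeval η (derivative (minpoly L η)) = δ := by
      rw [hmin, derivative_map, aeval_map_algebraMap]
    rw [← this, h0, map_zero]
  haveI : Algebra.IsSeparable L Fη :=
    (IntermediateField.isSeparable_adjoin_simple_iff_isSeparable L Ω).mpr hsep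
  set x : Fη := IntermediateField.AdjoinSimple.gen L η with hxdef
  have hxint : IsIntegral ↥(V.toSubring ⊓ L.toSubring) x :=
    (isIntegral_algHom_iff (IsScalarTower.toAlgHom ↥(V.toSubring ⊓ L.toSubring) Fη Ω)
      Subtype.val_injective).mp hint
  have hx : Algebra.adjoin L {x} = ⊤ := by
    have := (IntermediateField.adjoin.powerBasis hηint).adjoin_gen_eq_top
    rwa [IntermediateField.adjoin.powerBasis_gen] at this
  have hδ' : ((aeval x (derivative (minpoly L x)) : Fη) : Ω) = δ := by
    rw [hxdef, IntermediateField.minpoly_gen, hmin, derivative_map, ← IntermediateField.aeval_coe,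
      aeval_map_algebraMap]
    rfl
  have hadjA : ∀ a ∈ Algebra.adjoin ↥(V.toSubring ⊓ L.toSubring) {x}, ((a : Fη) : Ω) ∈ A := by
    intro a ha
    rw [Algebra.adjoin_singleton_eq_range_aeval] at ha
    obtain ⟨q, rfl⟩ := ha
    change ((aeval x q : Fη) : Ω) ∈ A
    rw [← IntermediateField.aeval_coe]
    exact hpolyA q
  refine ⟨A, hAV, hAF, hfpA, ?_, isSmoothAt_of_formallySmooth _, ?_⟩
  · -- `Frac A = F`
    have hLA : ∀ c ∈ L, c ∈ Subfield.closure (A : Set Ω) := by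
      intro c hcL
      by_cases hcV : c ∈ V
      · exact Subfield.subset_closure
          (A.algebraMap_mem (⟨c, hcV, hcL⟩ : ↥(V.toSubring ⊓ L.toSubring)))
      · have hci : c⁻¹ ∈ V := (V.mem_or_inv_mem c).resolve_left hcV
        rw [← inv_inv c]
        exact inv_mem (Subfield.subset_closure
          (A.algebraMap_mem (⟨c⁻¹, hci, L.inv_mem hcL⟩ : ↥(V.toSubring ⊓ L.toSubring))))
    have hηA : η ∈ A := by simpa using hpolyA X
    have hFA : F ≤ Subfield.closure (A : Set Ω) := by
      rw [← hgen]
      exact Subfield.closure_le.mpr (Set.union_subset hLA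
        (Set.singleton_subset_iff.mpr (Subfield.subset_closure hηA)))
    intro w hw
    exact exists_div_of_mem_closure A.toSubring (hFA hw)
  · -- `O_F ⊆ A_q`
    intro z hz
    obtain ⟨hzV, hzF⟩ := hZ z hz
    have hzFη : z ∈ Fη := by
      rw [hFη, mem_adjoin_subfield_iff, hgen]
      exact hzF
    obtain ⟨r, s, hrint, hsint, hvs, hrs⟩ := exists_isIntegral_mul_eq V L η hzV hzFη
    have hr' := derivative_mul_mem_adjoin_of_isIntegral ↥(V.toSubring ⊓ L.toSubring) L hx hxint
      hrint
    have hs' := derivative_mul_mem_adjoin_of_isIntegral ↥(V.toSubring ⊓ L.toSubring) L hx hxint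
      hsint
    have hs0 : (s : Ω) ≠ 0 := fun h0 => by
      rw [h0, map_zero] at hvs
      exact zero_ne_one hvs
    refine ⟨_, hadjA _ hr', _, hadjA _ hs', ?_, ?_⟩
    · rw [IntermediateField.coe_mul, hδ', map_mul, hder, hvs, one_mul]
    · rw [IntermediateField.coe_mul, IntermediateField.coe_mul, hδ', hrs]
      field_simp

end Literature.AlgebraicGeometry.Resolution

end
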